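import Summits.CriticalPhenomena.PercolationContinuityZ3.Theorems.PercNearOneGluingNoHeavyLowerTailSahiOneStepTwoLumpReduce
import Summits.CriticalPhenomena.PercolationContinuityZ3.Theorems.PercNearOneGluingNoHeavyLowerTailSahiOneStepTwoLumpLevels
import Summits.CriticalPhenomena.PercolationContinuityZ3.Theorems.PercNearOneGluingNoHeavyLowerTailSahiOneStepFreeBlock
import Summits.CriticalPhenomena.PercolationContinuityZ3.Theorems.PercNearOneGluingNoHeavyLowerTailSahiOneStepDualLump
import HarnessLib

/-!
# Two-sided lumping with a free block — part 3: the packaged partner reduction (`e`-free, `Ψ` not increased)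

Support file (prover prim-ineq-prove-3 gen 53; `--supports stmt-CriticalPhenomena-4575`; memo
`run/shared/lean/prim/prim-ineq-prove-3/PROOF-G53-TL-FREE-BLOCK.md` §2–§3).  No definitions, no named facts, no sorries, no `native_decide`.

**`exists_free_reduct2`**: slot `S ⊇ K = insert e F`, levels `t ≤ s` with `μ(Th_t S) < 1`, `0 < μ(Th_s S)`, densities in `(0,1)` on the free block
`S ∖ K` (arbitrary elsewhere); `A, B` increasing, `K`-determined, `A` `e`-dominant and `B` `e`-dominated over `F`.  Then there is an increasing
`K`-determined `B₂` NOT DEPENDING ON `e` with `Ψ(A, B₂) ≤ Ψ(A, B)` (`Ψ` = gen 50's two-sided lumping functional, written out).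
`B₂ = ↑(B♯ ∖ G)` for the two-sided costly region `G = (A ∩ Th_{g₁}K) ∪ Th_{g₂}K`, `g₂`/`g₁` the least levels with a positive outside / inside
coefficient; the sign pattern on the other levels is LEMMA U (`…TwoLumpLevels`, log-concavity of the free block), the monotonicity is
`twoLump_sharp_le` / `twoLump_lift_le` (`…TwoLumpReduce`), and `e`-freeness is `lift_free_region'`.
Also: `dualLump_threshold_nonneg_of_const_freeBlock` — the dual one-sided theorem (`Cov ≥ μ(U)·Cov(·|U)`) with a free block, by
complementation duality from `osN_threshold_nonneg_of_const_freeBlock`.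
-/

noncomputable section

namespace Summit.CriticalPhenomena.PercolationContinuityZ3.Theorems

namespace SahiOneStep

open MeasureTheory Finset unitInterval
open Literature.Probability.Percolation (DeterminedBy determinedBy_iff)
open Literature.Probability.LatticeModels (prodBernoulli prodBernoulli_harris prodBernoulli_harris_upper_lower)
open Literature.Probability.Percolation.DecisionTree (ind)
open scoped Classical

variable {ι : Type*} [Fintype ι]

omit [Fintype ι] in
/-- `{t ≤ #(R∩ω) + k} = {t − k ≤ #(R∩ω)}` (truncated subtraction). [folklore] -/
theorem shiftedThreshold_eq_threshold_tsub (R : Finset ι) (t k : ℕ) :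
    {ω : Set ι | t ≤ (R.filter (· ∈ ω)).card + k} = {ω : Set ι | t - k ≤ (R.filter (· ∈ ω)).card} := by
  ext ω; simp only [Set.mem_setOf_eq]; omega

omit [Fintype ι] in
/-- The two-sided costly region is `e`-dominant over `F` when `A` is. [this work] -/
theorem dominant_costly2 {F : Finset ι} {e : ι} {A : Set (Set ι)} (g₁ g₂ : ℕ)
    (hdomA : ∀ j ∈ F, ∀ ω ∈ A, e ∉ ω → j ∈ ω → (ω \ {j}) ∪ {e} ∈ A) :
    ∀ j ∈ F, ∀ ω ∈ (A ∩ {ω : Set ι | g₁ ≤ ((insert e F).filter (· ∈ ω)).card}) ∪ {ω : Set ι | g₂ ≤ ((insert e F).filter (· ∈ ω)).card},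
      e ∉ ω → j ∈ ω → (ω \ {j}) ∪ {e} ∈ (A ∩ {ω : Set ι | g₁ ≤ ((insert e F).filter (· ∈ ω)).card}) ∪ {ω : Set ι | g₂ ≤ ((insert e F).filter (· ∈ ω)).card} := by
  intro j hj ω hω heω hjω
  have hcard : ((insert e F).filter (· ∈ (ω \ {j}) ∪ {e})).card = ((insert e F).filter (· ∈ ω)).card :=
    card_filter_trade (Finset.mem_insert_of_mem hj) (Finset.mem_insert_self e F) hjω heω
  have hlev : ∀ g : ℕ, ω ∈ {ω : Set ι | g ≤ ((insert e F).filter (· ∈ ω)).card} →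
      (ω \ {j}) ∪ {e} ∈ {ω : Set ι | g ≤ ((insert e F).filter (· ∈ ω)).card} := by
    intro g hk
    simp only [Set.mem_setOf_eq] at hk ⊢
    rw [Finset.filter_congr_decidable (insert e F) (· ∈ (ω \ {j}) ∪ {e}) _, hcard]
    rwa [Finset.filter_congr_decidable (insert e F) (· ∈ ω) _] at hk
  rcases hω with ⟨hA, hk⟩ | hk
  · exact Or.inl ⟨hdomA j hj ω hA heω hjω, hlev g₁ hk⟩
  · exact Or.inr (hlev g₂ hk)

/-- **TWO-SIDED COSTLY-REGION REDUCTION** (memo §3 packaged). [this work] -/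
theorem exists_free_reduct2 (p : ι → unitInterval) {F S : Finset ι} {e : ι} (heF : e ∉ F) (hKS : insert e F ⊆ S)
    (hpR : ∀ i ∈ S \ insert e F, 0 < (p i : ℝ) ∧ (p i : ℝ) < 1) {t s : ℕ} (hts : t ≤ s)
    (hT : (prodBernoulli p).real {ω : Set ι | t ≤ (S.filter (· ∈ ω)).card} < 1) (hV : 0 < (prodBernoulli p).real {ω : Set ι | s ≤ (S.filter (· ∈ ω)).card})
    {A B : Set (Set ι)} (hA : IsUpperSet A) (hB : IsUpperSet B)
    (hAF : DeterminedBy A (↑(insert e F) : Set ι)) (hBF : DeterminedBy B (↑(insert e F) : Set ι))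
    (hdomA : ∀ j ∈ F, ∀ ω ∈ A, e ∉ ω → j ∈ ω → (ω \ {j}) ∪ {e} ∈ A)
    (hdomB : ∀ j ∈ F, ∀ ω ∈ B, e ∈ ω → j ∉ ω → (ω \ {e}) ∪ {j} ∈ B) :
    ∃ B₂ : Set (Set ι), IsUpperSet B₂ ∧ DeterminedBy B₂ (↑(insert e F) : Set ι) ∧
      (∀ ω : Set ι, insert e ω ∈ B₂ ↔ ω \ {e} ∈ B₂) ∧
      (1 - (prodBernoulli p).real {ω : Set ι | t ≤ (S.filter (· ∈ ω)).card}) * (prodBernoulli p).real {ω : Set ι | s ≤ (S.filter (· ∈ ω)).card} *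
          ((prodBernoulli p).real ({ω : Set ι | t ≤ (S.filter (· ∈ ω)).card} ∩ A ∩ B₂)
            - (prodBernoulli p).real ({ω : Set ι | s ≤ (S.filter (· ∈ ω)).card} ∩ A ∩ B₂))
        + (prodBernoulli p).real {ω : Set ι | s ≤ (S.filter (· ∈ ω)).card} *
          ((prodBernoulli p).real A - (prodBernoulli p).real ({ω : Set ι | t ≤ (S.filter (· ∈ ω)).card} ∩ A)) *
          ((prodBernoulli p).real B₂ - (prodBernoulli p).real ({ω : Set ι | t ≤ (S.filter (· ∈ ω)).card} ∩ B₂))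
        + (1 - (prodBernoulli p).real {ω : Set ι | t ≤ (S.filter (· ∈ ω)).card}) *
          (prodBernoulli p).real ({ω : Set ι | s ≤ (S.filter (· ∈ ω)).card} ∩ A) *
          (prodBernoulli p).real ({ω : Set ι | s ≤ (S.filter (· ∈ ω)).card} ∩ B₂)
        - (1 - (prodBernoulli p).real {ω : Set ι | t ≤ (S.filter (· ∈ ω)).card}) * (prodBernoulli p).real {ω : Set ι | s ≤ (S.filter (· ∈ ω)).card} *
          (prodBernoulli p).real A * (prodBernoulli p).real B₂ ≤
      (1 - (prodBernoulli p).real {ω : Set ι | t ≤ (S.filter (· ∈ ω)).card}) * (prodBernoulli p).real {ω : Set ι | s ≤ (S.filter (· ∈ ω)).card} *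
          ((prodBernoulli p).real ({ω : Set ι | t ≤ (S.filter (· ∈ ω)).card} ∩ A ∩ B)
            - (prodBernoulli p).real ({ω : Set ι | s ≤ (S.filter (· ∈ ω)).card} ∩ A ∩ B))
        + (prodBernoulli p).real {ω : Set ι | s ≤ (S.filter (· ∈ ω)).card} *
          ((prodBernoulli p).real A - (prodBernoulli p).real ({ω : Set ι | t ≤ (S.filter (· ∈ ω)).card} ∩ A)) *
          ((prodBernoulli p).real B - (prodBernoulli p).real ({ω : Set ι | t ≤ (S.filter (· ∈ ω)).card} ∩ B))
        + (1 - (prodBernoulli p).real {ω : Set ι | t ≤ (S.filter (· ∈ ω)).card}) *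
          (prodBernoulli p).real ({ω : Set ι | s ≤ (S.filter (· ∈ ω)).card} ∩ A) *
          (prodBernoulli p).real ({ω : Set ι | s ≤ (S.filter (· ∈ ω)).card} ∩ B)
        - (1 - (prodBernoulli p).real {ω : Set ι | t ≤ (S.filter (· ∈ ω)).card}) * (prodBernoulli p).real {ω : Set ι | s ≤ (S.filter (· ∈ ω)).card} *
          (prodBernoulli p).real A * (prodBernoulli p).real B := by
  set K : Finset ι := insert e F with hKdef
  -- Harris: `aL ≤ a ≤ aU ≤ 1`
  have hTup : IsUpperSet {ω : Set ι | t ≤ (S.filter (· ∈ ω)).card} := isUpperSet_threshold S t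
  have hVup : IsUpperSet {ω : Set ι | s ≤ (S.filter (· ∈ ω)).card} := isUpperSet_threshold S s
  have hHa1 : (prodBernoulli p).real A * (prodBernoulli p).real {ω : Set ι | t ≤ (S.filter (· ∈ ω)).card} ≤ (prodBernoulli p).real ({ω : Set ι | t ≤ (S.filter (· ∈ ω)).card} ∩ A) := by
    rw [mul_comm, Set.inter_comm]; rw [Set.inter_comm]
    exact prodBernoulli_harris p hTup hA MeasurableSet.of_discrete MeasurableSet.of_discrete
  have hHa2 : (prodBernoulli p).real A * (prodBernoulli p).real {ω : Set ι | s ≤ (S.filter (· ∈ ω)).card} ≤ (prodBernoulli p).real ({ω : Set ι | s ≤ (S.filter (· ∈ ω)).card} ∩ A) := by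
    rw [mul_comm]
    exact prodBernoulli_harris p hVup hA MeasurableSet.of_discrete MeasurableSet.of_discrete
  have hVA1 : (prodBernoulli p).real ({ω : Set ι | s ≤ (S.filter (· ∈ ω)).card} ∩ A) ≤ (prodBernoulli p).real {ω : Set ι | s ≤ (S.filter (· ∈ ω)).card} := measureReal_mono Set.inter_subset_left
  have hℓ : 0 < 1 - (prodBernoulli p).real {ω : Set ι | t ≤ (S.filter (· ∈ ω)).card} := by linarith
  -- the level coefficients, in LEMMA U's normal form
  have hconv : ∀ k : ℕ, ((prodBernoulli p).real {ω : Set ι | s ≤ (S.filter (· ∈ ω)).card} *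
            ((prodBernoulli p).real A - (prodBernoulli p).real ({ω : Set ι | t ≤ (S.filter (· ∈ ω)).card} ∩ A)) *
            (1 - (prodBernoulli p).real {ω : Set ι | t ≤ ((S \ K).filter (· ∈ ω)).card + k})
          + (1 - (prodBernoulli p).real {ω : Set ι | t ≤ (S.filter (· ∈ ω)).card}) *
            (prodBernoulli p).real ({ω : Set ι | s ≤ (S.filter (· ∈ ω)).card} ∩ A) *
            (prodBernoulli p).real {ω : Set ι | s ≤ ((S \ K).filter (· ∈ ω)).card + k}
          - (1 - (prodBernoulli p).real {ω : Set ι | t ≤ (S.filter (· ∈ ω)).card}) * (prodBernoulli p).real {ω : Set ι | s ≤ (S.filter (· ∈ ω)).card} *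
            (prodBernoulli p).real A) =
      ((1 - (prodBernoulli p).real {ω : Set ι | t ≤ (S.filter (· ∈ ω)).card}) * (prodBernoulli p).real {ω : Set ι | s ≤ (S.filter (· ∈ ω)).card}) *
        ((((prodBernoulli p).real A - (prodBernoulli p).real ({ω : Set ι | t ≤ (S.filter (· ∈ ω)).card} ∩ A)) / (1 - (prodBernoulli p).real {ω : Set ι | t ≤ (S.filter (· ∈ ω)).card})) * (1 - (prodBernoulli p).real {ω : Set ι | t - k ≤ ((S \ K).filter (· ∈ ω)).card})
          + ((prodBernoulli p).real ({ω : Set ι | s ≤ (S.filter (· ∈ ω)).card} ∩ A) / (prodBernoulli p).real {ω : Set ι | s ≤ (S.filter (· ∈ ω)).card}) * (prodBernoulli p).real {ω : Set ι | s - k ≤ ((S \ K).filter (· ∈ ω)).card} - (prodBernoulli p).real A) := by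
    intro k
    rw [shiftedThreshold_eq_threshold_tsub (S \ K) t k, shiftedThreshold_eq_threshold_tsub (S \ K) s k]
    field_simp
  have hconv' : ∀ k : ℕ, ((1 - (prodBernoulli p).real {ω : Set ι | t ≤ (S.filter (· ∈ ω)).card}) * (prodBernoulli p).real {ω : Set ι | s ≤ (S.filter (· ∈ ω)).card} *
            ((prodBernoulli p).real {ω : Set ι | t ≤ ((S \ K).filter (· ∈ ω)).card + k}
              - (prodBernoulli p).real {ω : Set ι | s ≤ ((S \ K).filter (· ∈ ω)).card + k})
          + ((prodBernoulli p).real {ω : Set ι | s ≤ (S.filter (· ∈ ω)).card} *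
              ((prodBernoulli p).real A - (prodBernoulli p).real ({ω : Set ι | t ≤ (S.filter (· ∈ ω)).card} ∩ A)) *
              (1 - (prodBernoulli p).real {ω : Set ι | t ≤ ((S \ K).filter (· ∈ ω)).card + k})
            + (1 - (prodBernoulli p).real {ω : Set ι | t ≤ (S.filter (· ∈ ω)).card}) *
              (prodBernoulli p).real ({ω : Set ι | s ≤ (S.filter (· ∈ ω)).card} ∩ A) *
              (prodBernoulli p).real {ω : Set ι | s ≤ ((S \ K).filter (· ∈ ω)).card + k}
            - (1 - (prodBernoulli p).real {ω : Set ι | t ≤ (S.filter (· ∈ ω)).card}) *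
              (prodBernoulli p).real {ω : Set ι | s ≤ (S.filter (· ∈ ω)).card} * (prodBernoulli p).real A)) =
      ((1 - (prodBernoulli p).real {ω : Set ι | t ≤ (S.filter (· ∈ ω)).card}) * (prodBernoulli p).real {ω : Set ι | s ≤ (S.filter (· ∈ ω)).card}) *
        ((((prodBernoulli p).real A - (prodBernoulli p).real ({ω : Set ι | t ≤ (S.filter (· ∈ ω)).card} ∩ A)) / (1 - (prodBernoulli p).real {ω : Set ι | t ≤ (S.filter (· ∈ ω)).card})) * (1 - (prodBernoulli p).real {ω : Set ι | t - k ≤ ((S \ K).filter (· ∈ ω)).card})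
          + ((prodBernoulli p).real ({ω : Set ι | s ≤ (S.filter (· ∈ ω)).card} ∩ A) / (prodBernoulli p).real {ω : Set ι | s ≤ (S.filter (· ∈ ω)).card}) * (prodBernoulli p).real {ω : Set ι | s - k ≤ ((S \ K).filter (· ∈ ω)).card} - (prodBernoulli p).real A
          + ((prodBernoulli p).real {ω : Set ι | t - k ≤ ((S \ K).filter (· ∈ ω)).card} - (prodBernoulli p).real {ω : Set ι | s - k ≤ ((S \ K).filter (· ∈ ω)).card})) := by
    intro k
    rw [shiftedThreshold_eq_threshold_tsub (S \ K) t k, shiftedThreshold_eq_threshold_tsub (S \ K) s k]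
    field_simp
    ring
  have hLa : ((prodBernoulli p).real A - (prodBernoulli p).real ({ω : Set ι | t ≤ (S.filter (· ∈ ω)).card} ∩ A)) / (1 - (prodBernoulli p).real {ω : Set ι | t ≤ (S.filter (· ∈ ω)).card}) ≤ (prodBernoulli p).real A := by
    rw [div_le_iff₀ hℓ]; nlinarith [hHa1]
  have haU : (prodBernoulli p).real A ≤ (prodBernoulli p).real ({ω : Set ι | s ≤ (S.filter (· ∈ ω)).card} ∩ A) / (prodBernoulli p).real {ω : Set ι | s ≤ (S.filter (· ∈ ω)).card} := by
    rw [le_div_iff₀ hV]; linarith [hHa2]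
  have haU0 : 0 ≤ (prodBernoulli p).real ({ω : Set ι | s ≤ (S.filter (· ∈ ω)).card} ∩ A) / (prodBernoulli p).real {ω : Set ι | s ≤ (S.filter (· ∈ ω)).card} := div_nonneg measureReal_nonneg hV.le
  have haU1 : (prodBernoulli p).real ({ω : Set ι | s ≤ (S.filter (· ∈ ω)).card} ∩ A) / (prodBernoulli p).real {ω : Set ι | s ≤ (S.filter (· ∈ ω)).card} ≤ 1 := by rw [div_le_iff₀ hV]; linarith
  have hℓu : 0 < (1 - (prodBernoulli p).real {ω : Set ι | t ≤ (S.filter (· ∈ ω)).card}) * (prodBernoulli p).real {ω : Set ι | s ≤ (S.filter (· ∈ ω)).card} := mul_pos hℓ hV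
  -- the costly levels `g₂` (outside) and `g₁` (inside)
  have hex₂ : ∃ k : ℕ, 0 < ((prodBernoulli p).real {ω : Set ι | s ≤ (S.filter (· ∈ ω)).card} *
            ((prodBernoulli p).real A - (prodBernoulli p).real ({ω : Set ι | t ≤ (S.filter (· ∈ ω)).card} ∩ A)) *
            (1 - (prodBernoulli p).real {ω : Set ι | t ≤ ((S \ K).filter (· ∈ ω)).card + k})
          + (1 - (prodBernoulli p).real {ω : Set ι | t ≤ (S.filter (· ∈ ω)).card}) *
            (prodBernoulli p).real ({ω : Set ι | s ≤ (S.filter (· ∈ ω)).card} ∩ A) *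
            (prodBernoulli p).real {ω : Set ι | s ≤ ((S \ K).filter (· ∈ ω)).card + k}
          - (1 - (prodBernoulli p).real {ω : Set ι | t ≤ (S.filter (· ∈ ω)).card}) * (prodBernoulli p).real {ω : Set ι | s ≤ (S.filter (· ∈ ω)).card} *
            (prodBernoulli p).real A) ∨ K.card < k := ⟨K.card + 1, Or.inr (Nat.lt_succ_self _)⟩
  have hex₁ : ∃ k : ℕ, 0 < ((1 - (prodBernoulli p).real {ω : Set ι | t ≤ (S.filter (· ∈ ω)).card}) * (prodBernoulli p).real {ω : Set ι | s ≤ (S.filter (· ∈ ω)).card} *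
            ((prodBernoulli p).real {ω : Set ι | t ≤ ((S \ K).filter (· ∈ ω)).card + k}
              - (prodBernoulli p).real {ω : Set ι | s ≤ ((S \ K).filter (· ∈ ω)).card + k})
          + ((prodBernoulli p).real {ω : Set ι | s ≤ (S.filter (· ∈ ω)).card} *
              ((prodBernoulli p).real A - (prodBernoulli p).real ({ω : Set ι | t ≤ (S.filter (· ∈ ω)).card} ∩ A)) *
              (1 - (prodBernoulli p).real {ω : Set ι | t ≤ ((S \ K).filter (· ∈ ω)).card + k})
            + (1 - (prodBernoulli p).real {ω : Set ι | t ≤ (S.filter (· ∈ ω)).card}) *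
              (prodBernoulli p).real ({ω : Set ι | s ≤ (S.filter (· ∈ ω)).card} ∩ A) *
              (prodBernoulli p).real {ω : Set ι | s ≤ ((S \ K).filter (· ∈ ω)).card + k}
            - (1 - (prodBernoulli p).real {ω : Set ι | t ≤ (S.filter (· ∈ ω)).card}) *
              (prodBernoulli p).real {ω : Set ι | s ≤ (S.filter (· ∈ ω)).card} * (prodBernoulli p).real A)) ∨ K.card < k := ⟨K.card + 1, Or.inr (Nat.lt_succ_self _)⟩
  set g₂ : ℕ := Nat.find hex₂ with hg₂
  set g₁ : ℕ := Nat.find hex₁ with hg₁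
  have hspec₂ := Nat.find_spec hex₂
  have hspec₁ := Nat.find_spec hex₁
  have hfree₂ : ∀ k, k < g₂ → ((prodBernoulli p).real {ω : Set ι | s ≤ (S.filter (· ∈ ω)).card} *
            ((prodBernoulli p).real A - (prodBernoulli p).real ({ω : Set ι | t ≤ (S.filter (· ∈ ω)).card} ∩ A)) *
            (1 - (prodBernoulli p).real {ω : Set ι | t ≤ ((S \ K).filter (· ∈ ω)).card + k})
          + (1 - (prodBernoulli p).real {ω : Set ι | t ≤ (S.filter (· ∈ ω)).card}) *
            (prodBernoulli p).real ({ω : Set ι | s ≤ (S.filter (· ∈ ω)).card} ∩ A) *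
            (prodBernoulli p).real {ω : Set ι | s ≤ ((S \ K).filter (· ∈ ω)).card + k}
          - (1 - (prodBernoulli p).real {ω : Set ι | t ≤ (S.filter (· ∈ ω)).card}) * (prodBernoulli p).real {ω : Set ι | s ≤ (S.filter (· ∈ ω)).card} *
            (prodBernoulli p).real A) ≤ 0 := by
    intro k hk
    have h := Nat.find_min hex₂ hk
    push Not at h
    exact h.1
  have hfree₁ : ∀ k, k < g₁ → ((1 - (prodBernoulli p).real {ω : Set ι | t ≤ (S.filter (· ∈ ω)).card}) * (prodBernoulli p).real {ω : Set ι | s ≤ (S.filter (· ∈ ω)).card} *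
            ((prodBernoulli p).real {ω : Set ι | t ≤ ((S \ K).filter (· ∈ ω)).card + k}
              - (prodBernoulli p).real {ω : Set ι | s ≤ ((S \ K).filter (· ∈ ω)).card + k})
          + ((prodBernoulli p).real {ω : Set ι | s ≤ (S.filter (· ∈ ω)).card} *
              ((prodBernoulli p).real A - (prodBernoulli p).real ({ω : Set ι | t ≤ (S.filter (· ∈ ω)).card} ∩ A)) *
              (1 - (prodBernoulli p).real {ω : Set ι | t ≤ ((S \ K).filter (· ∈ ω)).card + k})
            + (1 - (prodBernoulli p).real {ω : Set ι | t ≤ (S.filter (· ∈ ω)).card}) *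
              (prodBernoulli p).real ({ω : Set ι | s ≤ (S.filter (· ∈ ω)).card} ∩ A) *
              (prodBernoulli p).real {ω : Set ι | s ≤ ((S \ K).filter (· ∈ ω)).card + k}
            - (1 - (prodBernoulli p).real {ω : Set ι | t ≤ (S.filter (· ∈ ω)).card}) *
              (prodBernoulli p).real {ω : Set ι | s ≤ (S.filter (· ∈ ω)).card} * (prodBernoulli p).real A)) ≤ 0 := by
    intro k hk
    have h := Nat.find_min hex₁ hk
    push Not at h
    exact h.1
  have hcost₂ : ∀ k, k ≤ K.card → g₂ ≤ k → 0 ≤ ((prodBernoulli p).real {ω : Set ι | s ≤ (S.filter (· ∈ ω)).card} *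
            ((prodBernoulli p).real A - (prodBernoulli p).real ({ω : Set ι | t ≤ (S.filter (· ∈ ω)).card} ∩ A)) *
            (1 - (prodBernoulli p).real {ω : Set ι | t ≤ ((S \ K).filter (· ∈ ω)).card + k})
          + (1 - (prodBernoulli p).real {ω : Set ι | t ≤ (S.filter (· ∈ ω)).card}) *
            (prodBernoulli p).real ({ω : Set ι | s ≤ (S.filter (· ∈ ω)).card} ∩ A) *
            (prodBernoulli p).real {ω : Set ι | s ≤ ((S \ K).filter (· ∈ ω)).card + k}
          - (1 - (prodBernoulli p).real {ω : Set ι | t ≤ (S.filter (· ∈ ω)).card}) * (prodBernoulli p).real {ω : Set ι | s ≤ (S.filter (· ∈ ω)).card} *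
            (prodBernoulli p).real A) := by
    intro k hkK hk
    rcases hspec₂ with hpos | hbig
    · rw [hconv] at hpos ⊢
      have hpos' := pos_of_mul_pos_right hpos hℓu.le
      exact (mul_pos hℓu (levelCoeff_out_pos_stable_layer p (S \ K) hpR hts hLa haU0 hk hpos')).le
    · omega
  have hcost₁ : ∀ k, k ≤ K.card → g₁ ≤ k → 0 ≤ ((1 - (prodBernoulli p).real {ω : Set ι | t ≤ (S.filter (· ∈ ω)).card}) * (prodBernoulli p).real {ω : Set ι | s ≤ (S.filter (· ∈ ω)).card} *
            ((prodBernoulli p).real {ω : Set ι | t ≤ ((S \ K).filter (· ∈ ω)).card + k}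
              - (prodBernoulli p).real {ω : Set ι | s ≤ ((S \ K).filter (· ∈ ω)).card + k})
          + ((prodBernoulli p).real {ω : Set ι | s ≤ (S.filter (· ∈ ω)).card} *
              ((prodBernoulli p).real A - (prodBernoulli p).real ({ω : Set ι | t ≤ (S.filter (· ∈ ω)).card} ∩ A)) *
              (1 - (prodBernoulli p).real {ω : Set ι | t ≤ ((S \ K).filter (· ∈ ω)).card + k})
            + (1 - (prodBernoulli p).real {ω : Set ι | t ≤ (S.filter (· ∈ ω)).card}) *
              (prodBernoulli p).real ({ω : Set ι | s ≤ (S.filter (· ∈ ω)).card} ∩ A) *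
              (prodBernoulli p).real {ω : Set ι | s ≤ ((S \ K).filter (· ∈ ω)).card + k}
            - (1 - (prodBernoulli p).real {ω : Set ι | t ≤ (S.filter (· ∈ ω)).card}) *
              (prodBernoulli p).real {ω : Set ι | s ≤ (S.filter (· ∈ ω)).card} * (prodBernoulli p).real A)) := by
    intro k hkK hk
    rcases hspec₁ with hpos | hbig
    · rw [hconv'] at hpos ⊢
      have hpos' := pos_of_mul_pos_right hpos hℓu.le
      exact mul_nonneg hℓu.le (levelCoeff_in_nonneg_stable_layer p (S \ K) hpR hts hLa haU haU1 hk hpos')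
    · omega
  have hg : g₁ ≤ g₂ := by
    refine Nat.find_le ?_
    rcases hspec₂ with hpos | hbig
    · left
      have hτσ : (prodBernoulli p).real {ω : Set ι | s ≤ ((S \ K).filter (· ∈ ω)).card + g₂} ≤ (prodBernoulli p).real {ω : Set ι | t ≤ ((S \ K).filter (· ∈ ω)).card + g₂} :=
        measureReal_mono fun ω hω => by simp only [Set.mem_setOf_eq] at hω ⊢; omega
      have : 0 ≤ (1 - (prodBernoulli p).real {ω : Set ι | t ≤ (S.filter (· ∈ ω)).card}) * (prodBernoulli p).real {ω : Set ι | s ≤ (S.filter (· ∈ ω)).card} * ((prodBernoulli p).real {ω : Set ι | t ≤ ((S \ K).filter (· ∈ ω)).card + g₂} - (prodBernoulli p).real {ω : Set ι | s ≤ ((S \ K).filter (· ∈ ω)).card + g₂}) := mul_nonneg hℓu.le (by linarith)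
      linarith
    · exact Or.inr hbig
  -- the reduction
  set G : Set (Set ι) := (A ∩ {ω : Set ι | g₁ ≤ (K.filter (· ∈ ω)).card}) ∪ {ω : Set ι | g₂ ≤ (K.filter (· ∈ ω)).card} with hGdef
  set Bs : Set (Set ι) := {ω : Set ι | ∀ ω'' : Set ι, ω ⊆ ω'' → ω'' ∈ G → ω'' ∈ B} with hBsdef
  set B₂ : Set (Set ι) := {ω : Set ι | ∃ ω' : Set ι, ω' ⊆ ω ∧ ω' ∈ Bs ∧ ω' ∉ G} with hB₂def
  have hGup : IsUpperSet G := isUpperSet_costly2 hA K g₁ g₂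
  have hGK : DeterminedBy G (↑K : Set ι) := determinedBy_costly2 hAF g₁ g₂
  have hBsup : IsUpperSet Bs := isUpperSet_hgen G B
  have hBsK : DeterminedBy Bs (↑K : Set ι) := determinedBy_hgen hGK hBF
  have hB₂up : IsUpperSet B₂ := isUpperSet_lift Bs G
  refine ⟨B₂, hB₂up, determinedBy_lift hBsK hGK, fun ω => ⟨fun h => ?_, fun h => ?_⟩, ?_⟩
  · have h' : insert e (ω \ {e}) ∈ B₂ := by rwa [Set.insert_sdiff_singleton]
    exact lift_free_region' heF hGup hGK hBF (dominant_costly2 g₁ g₂ hdomA) hdomB (ω \ {e}) (fun h => h.2 rfl) h'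
  · exact hB₂up (Set.sdiff_subset.trans (Set.subset_insert e ω)) h
  · exact (twoLump_lift_le p hKS t s hBsup hAF hBsK hg hcost₂ hcost₁).trans (twoLump_sharp_le p hKS t s hB hAF hBF hfree₂ hfree₁)

omit [Fintype ι] in
/-- `Ψ(univ, B) = 0`. [this work] -/
theorem twoLump_univ_left (p : ι → unitInterval) (S : Finset ι) (t s : ℕ) (B : Set (Set ι)) :
    (1 - (prodBernoulli p).real {ω : Set ι | t ≤ (S.filter (· ∈ ω)).card}) *
        (prodBernoulli p).real {ω : Set ι | s ≤ (S.filter (· ∈ ω)).card} *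
        ((prodBernoulli p).real ({ω : Set ι | t ≤ (S.filter (· ∈ ω)).card} ∩ Set.univ ∩ B)
          - (prodBernoulli p).real ({ω : Set ι | s ≤ (S.filter (· ∈ ω)).card} ∩ Set.univ ∩ B))
    + (prodBernoulli p).real {ω : Set ι | s ≤ (S.filter (· ∈ ω)).card} *
        ((prodBernoulli p).real Set.univ - (prodBernoulli p).real ({ω : Set ι | t ≤ (S.filter (· ∈ ω)).card} ∩ Set.univ)) *
        ((prodBernoulli p).real B - (prodBernoulli p).real ({ω : Set ι | t ≤ (S.filter (· ∈ ω)).card} ∩ B))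
    + (1 - (prodBernoulli p).real {ω : Set ι | t ≤ (S.filter (· ∈ ω)).card}) *
        (prodBernoulli p).real ({ω : Set ι | s ≤ (S.filter (· ∈ ω)).card} ∩ Set.univ) *
        (prodBernoulli p).real ({ω : Set ι | s ≤ (S.filter (· ∈ ω)).card} ∩ B)
    - (1 - (prodBernoulli p).real {ω : Set ι | t ≤ (S.filter (· ∈ ω)).card}) *
        (prodBernoulli p).real {ω : Set ι | s ≤ (S.filter (· ∈ ω)).card} *
        (prodBernoulli p).real Set.univ * (prodBernoulli p).real B = 0 := by
  simp only [Set.inter_univ, probReal_univ]; ring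

omit [Fintype ι] in
/-- `Ψ(∅, B) = 0`. [this work] -/
theorem twoLump_empty_left (p : ι → unitInterval) (S : Finset ι) (t s : ℕ) (B : Set (Set ι)) :
    (1 - (prodBernoulli p).real {ω : Set ι | t ≤ (S.filter (· ∈ ω)).card}) *
        (prodBernoulli p).real {ω : Set ι | s ≤ (S.filter (· ∈ ω)).card} *
        ((prodBernoulli p).real ({ω : Set ι | t ≤ (S.filter (· ∈ ω)).card} ∩ (∅ : Set (Set ι)) ∩ B)
          - (prodBernoulli p).real ({ω : Set ι | s ≤ (S.filter (· ∈ ω)).card} ∩ (∅ : Set (Set ι)) ∩ B))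
    + (prodBernoulli p).real {ω : Set ι | s ≤ (S.filter (· ∈ ω)).card} *
        ((prodBernoulli p).real (∅ : Set (Set ι)) - (prodBernoulli p).real ({ω : Set ι | t ≤ (S.filter (· ∈ ω)).card} ∩ (∅ : Set (Set ι)))) *
        ((prodBernoulli p).real B - (prodBernoulli p).real ({ω : Set ι | t ≤ (S.filter (· ∈ ω)).card} ∩ B))
    + (1 - (prodBernoulli p).real {ω : Set ι | t ≤ (S.filter (· ∈ ω)).card}) *
        (prodBernoulli p).real ({ω : Set ι | s ≤ (S.filter (· ∈ ω)).card} ∩ (∅ : Set (Set ι))) *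
        (prodBernoulli p).real ({ω : Set ι | s ≤ (S.filter (· ∈ ω)).card} ∩ B)
    - (1 - (prodBernoulli p).real {ω : Set ι | t ≤ (S.filter (· ∈ ω)).card}) *
        (prodBernoulli p).real {ω : Set ι | s ≤ (S.filter (· ∈ ω)).card} *
        (prodBernoulli p).real (∅ : Set (Set ι)) * (prodBernoulli p).real B = 0 := by
  simp only [Set.inter_empty, Set.empty_inter, measureReal_empty]; ring

/-- **The dual one-sided theorem with a free block** (`Cov ≥ μ(U)·Cov(·|U)` for the upper ball `U = {s ≤ N}`): density constant `P ∈ (0,1)` on `F`,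
arbitrary in `(0,1)` on the disjoint block `E`, `A, B` increasing and `F`-determined.  By complementation duality (`dualLump_eq_osN_compl`) from
`osN_threshold_nonneg_of_const_freeBlock` at the reflected densities. [this work] -/
theorem dualLump_threshold_nonneg_of_const_freeBlock (p : ι → unitInterval) {P : ℝ} (hP0 : 0 < P) (hP1 : P < 1) (E : Finset ι)
    (hpE : ∀ i ∈ E, 0 < (p i : ℝ) ∧ (p i : ℝ) < 1) (F : Finset ι) (hFE : Disjoint F E)
    (hpF : ∀ i ∈ F, (p i : ℝ) = P) (s : ℕ) {A B : Set (Set ι)} (hA : IsUpperSet A) (hB : IsUpperSet B)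
    (hAF : DeterminedBy A (↑F : Set ι)) (hBF : DeterminedBy B (↑F : Set ι)) :
    0 ≤ (prodBernoulli p).real {ω : Set ι | s ≤ ((F ∪ E).filter (· ∈ ω)).card} *
          (prodBernoulli p).real ((A ∩ B) \ {ω : Set ι | s ≤ ((F ∪ E).filter (· ∈ ω)).card})
        + (prodBernoulli p).real (A ∩ {ω : Set ι | s ≤ ((F ∪ E).filter (· ∈ ω)).card}) *
          (prodBernoulli p).real (B ∩ {ω : Set ι | s ≤ ((F ∪ E).filter (· ∈ ω)).card})
        - (prodBernoulli p).real {ω : Set ι | s ≤ ((F ∪ E).filter (· ∈ ω)).card} * (prodBernoulli p).real A * (prodBernoulli p).real B := by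
  by_cases hs : s ≤ (F ∪ E).card + 1
  · rw [dualLump_eq_osN_compl p (F ∪ E) hs A B]
    refine osN_threshold_nonneg_of_const_freeBlock (fun i => σ (p i)) (P := 1 - P) (by linarith) (by linarith) E (fun i hi => ?_) F hFE
      (fun i hi => ?_) ((F ∪ E).card + 1 - s) (isUpperSet_compl_preimage_compl hA) (isUpperSet_compl_preimage_compl hB)
      (determinedBy_compl_preimage_compl hAF) (determinedBy_compl_preimage_compl hBF)
    · simp only [unitInterval.coe_symm_eq]
      constructor <;> linarith [(hpE i hi).1, (hpE i hi).2]
    · rw [unitInterval.coe_symm_eq, hpF i hi]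
  · rw [threshold_eq_empty_of_card_lt (F ∪ E) (by omega)]
    simp


end SahiOneStep

end Summit.CriticalPhenomena.PercolationContinuityZ3.Theorems
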